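import Mathlib.Algebra.MvPolynomial.PDeriv
import Mathlib.RingTheory.PowerSeries.Derivative
import Mathlib.RingTheory.PowerSeries.Order
import Mathlib.RingTheory.MvPolynomial.Basic
import Mathlib.Analysis.Complex.Basic
import HarnessLib

/-!
# Nesterenko's multiplicity estimate for solutions of algebraic differential equations with the `D`-property (LNM 1752 Ch. 10 Theorem 1.1)

Topic `Literature/NumberTheory/Transcendental`. Yu. V. Nesterenko, Ch. 10 of Nesterenko–Philippon
(eds.), LNM 1752 (2001), "Multiplicity estimates for solutions of algebraic differential equations",
§1 (pp. 149–151): the system (39) `y_j' = A_j(z, ȳ)/A₀(z, ȳ)` (`A_j ∈ ℂ[z, y₁, …, y_m]` without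
non-constant common divisor), its differential operator (40)
`D = A₀ ∂/∂z + ∑ A_j ∂/∂x_j` on `ℂ[z, x₁, …, x_m]`, `D`-stable prime ideals, the `D`-property
(Definition 1.2) of an analytic solution `f̄ = (f₁, …, f_m)` at `z = 0`, and

  THEOREM 1.1. Suppose that functions `f̄ = (f₁(z), …, f_m(z))` are analytic at the point `z = 0`
  and form a solution of the system (39). If these functions have the `D`-property at the point `0`,
  then there exists a constant `c₁ > 0` depending only on `f̄`, such that for any polynomial
  `A ∈ ℂ[z, x₁, …, x_m]`, `A ≠ 0`, the following inequality holds
  `ord_{z=0} A(z, f₁(z), …, f_m(z)) ≤ c₁ (deg_z A + 1)(deg_x̲ A + 1)^m`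

(vendored as the named fact `NesterenkoPhilippon2001_ch10_thm_1_1`; proved in print in §§2–4 from
the `ℂ(z)`-version of the Ch. 3 §4 machinery and the Hilbert-function bound of Ch. 9). Its
Example 3 / Theorem 1.3 (the Ramanujan functions `P, Q, R`, via the `D`-property of §5,
Proposition 5.1) is Theorem 2.3 of Ch. 3, the multiplicity estimate of Nesterenko's theorem
(`Literature.Barriers.Schanuel.NesterenkoPhilippon2001_ch3_thm_2_3`); the deduction is in
`Literature/Barriers/Schanuel/NesterenkoModularScopeDProperty*.lean`.

## Encodings

* `ℂ[z, x₁, …, x_m]` is `Rzx m = MvPolynomial (Fin (m+1)) ℂ`, the variable `0` being `z` and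
  `Fin.succ j` being `x_{j+1}`; the system data is `A : Fin (m+1) → Rzx m` (`A 0 = A₀`,
  `A j.succ = A_j`).
* An analytic `f_j` at `0` is its Taylor series `f j : PowerSeries ℂ` with a positive radius of
  convergence (`HasPosRadius`); `E(z, f̄(z))` is the formal composite `substSeries f E`
  (`x_j ↦ f_j`, `z ↦ z`) and `ord_{z=0}` is `PowerSeries.order` (in `ℕ∞`).
* "`f̄` form a solution of (39)": the identities `A₀(z, f̄) · f_j' = A_j(z, f̄)` of power series with
  `A₀(z, f̄) ≢ 0` (equivalent, for analytic `f̄`, to (39) wherever `A₀(z, f̄(z)) ≠ 0`) — `IsSolution`.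
* "no non-constant common divisors" — `NoCommonDivisor`; `D` of (40) — `dOp A`; "`D𝔞 ⊆ 𝔞`" —
  `IsDStable`; Definition 1.2 — `HasDProperty` (the constant `c` may be taken in `ℕ`);
  `deg_z` = `degreeOf 0`, `deg_x̲` = total degree in `x₁, …, x_m` — `xDegree` (the `x₀`-power in the
  homogenisation `x₀^{deg_x̲ A} A(x/x₀)` of §2); the absolute constant `c₁` is taken in `ℕ` (round up).

Nothing is asserted.

## References

* [NesterenkoPhilippon2001] Yu. V. Nesterenko, P. Philippon (eds.), *Introduction to Algebraic
  Independence Theory*, LNM 1752, Springer 2001, Ch. 10 (Yu. V. Nesterenko) §1: (39)–(42),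
  Definition 1.2, Theorem 1.1, Example 3 and Theorem 1.3 (pp. 149–151 = PDF pp. 179–181); §2
  (the homogenisation `x₀^{deg_x̲ A} A(x/x₀)`, p. 153).
* [Nes2] Yu. V. Nesterenko, Izv. Akad. Nauk SSSR Ser. Mat. 41 (1977) 253–284 (the method).
-/

noncomputable section

open MvPolynomial

namespace Literature.NumberTheory.Transcendental

namespace NesterenkoMultiplicity

/-- `ℂ[z, x₁, …, x_m]`: variable `0` is `z`, variable `Fin.succ j` is `x_{j+1}`.
[cite: NesterenkoPhilippon2001, Ch. 10 §1 (p. 149)] -/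
abbrev Rzx (m : ℕ) : Type := MvPolynomial (Fin (m + 1)) ℂ

variable {m : ℕ}

/-- The composite `E(z, f₁(z), …, f_m(z))` of `E ∈ ℂ[z, x̲]` with power series `f_j` (the
substitution `z ↦ z`, `x_j ↦ f_j`), as a `ℂ`-algebra map to `ℂ⟦z⟧`.
[cite: NesterenkoPhilippon2001, Ch. 10 §1 (p. 149)] -/
def substSeries (f : Fin m → PowerSeries ℂ) : Rzx m →ₐ[ℂ] PowerSeries ℂ :=
  MvPolynomial.aeval (Fin.cons PowerSeries.X f)

/-- `substSeries` on the variables: `z ↦ z`. [folklore] -/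
@[simp] theorem substSeries_X_zero (f : Fin m → PowerSeries ℂ) :
    substSeries f (X 0) = PowerSeries.X := by
  simp [substSeries]

/-- `substSeries` on the variables: `x_j ↦ f_j`. [folklore] -/
@[simp] theorem substSeries_X_succ (f : Fin m → PowerSeries ℂ) (j : Fin m) :
    substSeries f (X j.succ) = f j := by
  simp [substSeries]

/-- **(40)**: the differential operator `D E = A₀ ∂E/∂z + ∑_j A_j ∂E/∂x_j` attached to the system
(39). [cite: NesterenkoPhilippon2001, Ch. 10 §1 (40) (p. 150)] -/
def dOp (A : Fin (m + 1) → Rzx m) (E : Rzx m) : Rzx m :=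
  ∑ i : Fin (m + 1), A i * pderiv i E

/-- `D` is additive. [folklore] -/
theorem dOp_add (A : Fin (m + 1) → Rzx m) (E F : Rzx m) :
    dOp A (E + F) = dOp A E + dOp A F := by
  simp only [dOp, map_add, mul_add, Finset.sum_add_distrib]

/-- Leibniz rule for `D`. [folklore] -/
theorem dOp_mul (A : Fin (m + 1) → Rzx m) (E F : Rzx m) :
    dOp A (E * F) = dOp A E * F + E * dOp A F := by
  simp only [dOp, Derivation.leibniz, smul_eq_mul, Finset.sum_mul, Finset.mul_sum,
    ← Finset.sum_add_distrib]
  refine Finset.sum_congr rfl fun i _ => ?_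
  ring

/-- `D` on the variables: `D z = A₀`, `D x_j = A_j`. [folklore] -/
theorem dOp_X (A : Fin (m + 1) → Rzx m) (i : Fin (m + 1)) : dOp A (X i) = A i := by
  classical
  simp only [dOp, pderiv_X]
  rw [Finset.sum_eq_single i]
  · simp [Pi.single_eq_same]
  · intro b _ hb
    simp [Pi.single_eq_of_ne hb.symm]
  · intro h; exact absurd (Finset.mem_univ i) h

/-- "`D𝔞 ⊆ 𝔞`": the ideal `𝔞` is stable under `D`.
[cite: NesterenkoPhilippon2001, Ch. 10 Def. 1.2 (p. 150)] -/
def IsDStable (A : Fin (m + 1) → Rzx m) (𝔞 : Ideal (Rzx m)) : Prop :=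
  ∀ E ∈ 𝔞, dOp A E ∈ 𝔞

/-- "`f` analytic at `0`" for a Taylor series: positive radius of convergence.
[cite: NesterenkoPhilippon2001, Ch. 10 §1 (p. 149)] -/
def HasPosRadius (φ : PowerSeries ℂ) : Prop :=
  ∃ r : ℝ, 0 < r ∧ Summable fun n : ℕ => ‖PowerSeries.coeff n φ‖ * r ^ n

/-- "`f̄` form a solution of the system (39) `y_j' = A_j(z, ȳ)/A₀(z, ȳ)`", as identities of power
series with the denominator cleared: `A₀(z, f̄) · f_j' = A_j(z, f̄)` for all `j`, and
`A₀(z, f̄) ≢ 0`. [cite: NesterenkoPhilippon2001, Ch. 10 §1 (39) (p. 149)] -/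
def IsSolution (A : Fin (m + 1) → Rzx m) (f : Fin m → PowerSeries ℂ) : Prop :=
  substSeries f (A 0) ≠ 0 ∧
    ∀ j : Fin m, substSeries f (A 0) * PowerSeries.derivative ℂ (f j) = substSeries f (A j.succ)

/-- "We assume that these polynomials have no non constant common divisors": every common divisor
of `A₀, …, A_m` is a constant. [cite: NesterenkoPhilippon2001, Ch. 10 §1 (p. 149)] -/
def NoCommonDivisor (A : Fin (m + 1) → Rzx m) : Prop :=
  ∀ G : Rzx m, (∀ i, G ∣ A i) → G.totalDegree = 0

/-- **Definition 1.2 (the `D`-property at `0`)**: there is a constant `c` such that every non-zero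
prime ideal `𝔞 ⊆ ℂ[z, x̲]` stable under `D` contains a polynomial `E` with
`ord_{z=0} E(z, f̄) ≤ c` ("`min_{E ∈ 𝔞} ord E(z, f̄) ≤ c`").
[cite: NesterenkoPhilippon2001, Ch. 10 Def. 1.2 (42) (p. 150)] -/
def HasDProperty (A : Fin (m + 1) → Rzx m) (f : Fin m → PowerSeries ℂ) : Prop :=
  ∃ c : ℕ, ∀ 𝔞 : Ideal (Rzx m), 𝔞.IsPrime → 𝔞 ≠ ⊥ → IsDStable A 𝔞 →
    ∃ E ∈ 𝔞, (substSeries f E).order ≤ c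

/-- `deg_x̲ E`: the total degree of `E ∈ ℂ[z, x₁, …, x_m]` in the variables `x₁, …, x_m` alone
(the exponent of `x₀` in the homogenisation `x₀^{deg_x̲ E} E(x/x₀)` of Ch. 10 §2).
[cite: NesterenkoPhilippon2001, Ch. 10 §1 Thm 1.1 and §2 (p. 153)] -/
def xDegree (E : Rzx m) : ℕ :=
  E.support.sup fun e => ∑ j : Fin m, e j.succ

/-- Every monomial's `x̲`-degree is bounded by the sum of the partial degrees `deg_{x_j}`. [folklore] -/
theorem xDegree_le_sum_degreeOf (E : Rzx m) : xDegree E ≤ ∑ j : Fin m, E.degreeOf j.succ := by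
  refine Finset.sup_le fun e he => Finset.sum_le_sum fun j _ => ?_
  exact monomial_le_degreeOf j.succ he

/-- **LNM 1752 Ch. 10 Theorem 1.1** (Nesterenko's multiplicity estimate under the `D`-property):
let `f̄ = (f₁, …, f_m)` (`m ≥ 1`) be analytic at `0` and form a solution of the system (39) with
data `A₀, …, A_m ∈ ℂ[z, x̲]` without non-constant common divisor; if `f̄` has the `D`-property at
`0`, there is a constant `c₁ > 0` (depending only on `f̄`; here in `ℕ`) such that for every non-zero
`E ∈ ℂ[z, x₁, …, x_m]`, `ord_{z=0} E(z, f̄(z)) ≤ c₁ (deg_z E + 1)(deg_x̲ E + 1)^m`. Users take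
`(h : NesterenkoPhilippon2001_ch10_thm_1_1)`.
[cite: NesterenkoPhilippon2001, Ch. 10 Theorem 1.1 (p. 150)] -/
def NesterenkoPhilippon2001_ch10_thm_1_1 : Prop :=
  ∀ (m : ℕ), 1 ≤ m → ∀ (A : Fin (m + 1) → Rzx m) (f : Fin m → PowerSeries ℂ),
    NoCommonDivisor A → (∀ j, HasPosRadius (f j)) → IsSolution A f → HasDProperty A f →
    ∃ c₁ : ℕ, 0 < c₁ ∧ ∀ E : Rzx m, E ≠ 0 →
      (substSeries f E).order ≤ ((c₁ * (E.degreeOf 0 + 1) * (xDegree E + 1) ^ m : ℕ) : ℕ∞)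

end NesterenkoMultiplicity

end Literature.NumberTheory.Transcendental

end
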